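import Literature.MathematicalPhysics.QuantumFieldTheory.Volkov2020.HeppSectorTreeBounds
import HarnessLib

/-!
# Volkov 2020 (NPB 961, 115232) §3.2 eq. (3.4): Lemma 3.4's denominator bound `(z′_i)²/max(z′_i, z_i)` in Hepp-sector variables — the exact exponent vs the printed one — read literally the display's «=» is a «≥» and Lemmas 3.6–3.7 fail on the one-loop graph; read with Ph(IClos(s)) := the photons whose lepton path lies in s (= Ph(IClos(Lept s))) everything holds AS PRINTED (PROVED; Theorem 3.1 unaffected)

independent recomputation; certified where stated, statistical where stated; no new-physics claim.

CITATION HEADER (venture `QEDPrecision`, cell `pub-qed`, track TROPICAL seat V3b = `pub-qed-trop-v3-lit-2` gen 8; VALUE-FREE: monomial bookkeeping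
in sector variables only — no integrand, nothing per word). Companion of `Volkov2020.HeppSectorTreeBounds` (Lemmas 3.1–3.3; its `heppZ`, `suffix`),
`Volkov2020.DenominatorLemmaArithmetic` (Lemma 3.4 itself) and `Volkov2020.UVDegreeHandshake` (the ω / I-closure step of Lemma 3.5); serves
`tropical/view/V3-VOLKOV-DEGREES.md` §B B.24 («not in the kernel: eq. (3.4)») and B.21 (i) (caveat when a per-face exponent is read off print).

Source. [Volkov2020] S. Volkov, "Infrared and ultraviolet power counting on the mass shell in quantum electrodynamics", Nucl. Phys. B 961
(2020) 115232 = arXiv:1912.04885v4 (e-print tex `iclos_arxiv.tex` held by the cell under `pub-qed-trop-v3-lit-2/sources/arxiv-1912.04885/`;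
journal pages from the cell's page files `data/lit/sources/.cache/journal-pdf-pages/NPB961-115232-Volkov2020/`), VERBATIM:
* §2.1 (journal p.7; tex l.168–173): "If i ∈ Ph(E(G)), then by LPath(i) we denote the set of all lines that are on the lepton path connecting
  the vertexes incident to i. By definition, put IClos(s) = s ∪ {i ∈ Ph(E(G)) : LPath(i) ⊆ s}."
* §3.1 (journal p.10; tex l.296–302): the sector z_{j₁} ≥ … ≥ z_{j_L}, s^{[l]} = {j_l,…,j_L}, "t₁ = z_{j₁}, t₂ = z_{j₂}/z_{j₁}, …, t_L = z_{j_L}/z_{j_{L−1}}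
  … Therefore, t₁,…,t_L ≤ 1."
* §3.2 Lemma 3.4 (journal p.12; tex l.361–370): "|W(z)| ≥ C·max_{i∈Ph(E(G))} (z′_i)²/max(z′_i, z_i), where z′_i = max_{l∈LPath(i)} z_l".
* §3.2 **eq. (3.4)** (journal p.13; tex l.396–405): "Let us describe an idea how to transform the estimation from Lemma 3.4 to the form like
  ∏ t_l^{d_l}. If r_i ≥ 0, i ∈ Ph(E(G)) are some real numbers, M = Σ_i r_i, then we have
  |W(z)|^M ≥ C·∏_{i∈Ph(E(G))} ((z′_i)²/max(z′_i, z_i))^{r_i} = C·∏_{l=1}^{L} t_l^{a_l}, (3.4) where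
  a_l = Σ_{i∈Ph(IClos(s^{[l]}))} r_i + Σ_{i∈IClos(s^{[l]})∖s^{[l]}} r_i."
* §3.2 Lemma 3.5, proof (journal p.13; tex l.421–431): "The power of t_l is constituted of the following terms: … −Σ_{i∈Ph(IClos(s^{[l]}))} r_i −
  Σ_{i∈IClos(s^{[l]})∖s^{[l]}} r_i (from (3.4))." — i.e. downstream only the LOWER bound |W|^M ≥ C∏ t_l^{a_l} is used — with (3.6)
  "A_l = ⌊|Lept(s^{[l]})|/2⌋ − |P(s^{[l]})| − Σ_{i∈Ph(IClos(s^{[l]}))} r_i".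
* §3.2 **Lemma 3.6** (journal p.13; tex l.442–459): "For any s ⊆ E(G) we have |Ph(IClos(s))| ≤ ⌊|Lept(s)|/2⌋." Proof: "… we consider Lept(s) as
  the union of paths h₁,…,h_l (that are not connected). … For each path h_j there exists a photon line of G (internal or external) with exactly
  one vertex on h_j. Taking to account that h_j has |h_j|+1 vertexes, and one vertex is already occupied by that photon, there are no more than
  |h_j|/2 photons with ends on h_j contributing to |Ph(IClos(s))|. …"
* §3.2 **Lemma 3.7** (journal p.14; tex l.460–484): "There exist numbers r_i ∈ {0,1} for i ∈ Ph(E(G)) such that Σ_i r_i = L + u[P] and for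
  any l = 1,…,L we have Σ_{i∈Ph(IClos(s^{[l]}))} r_i ≤ ⌊Lept(s^{[l]})/2⌋ − |P[s^{[l]}]|. (3.8)" with "L + u[P] = |Ph(E(G))| − |P|" and the
  construction "we start from r_i = 1 for all i and … for l = L, L−1, …, 1: if (3.9) is not satisfied for l, then change some r_i for
  i ∈ Ph(IClos(s^{[l]})) to zero …".

WHAT THIS FILE RECORDS (a print-check with its kernel certificate). In the sector variables (lines numbered along the sector as in
`HeppSectorTreeBounds`: line `k : Fin L` is Volkov's j_{k+1}, `z_k = t_0⋯t_k`, `s^{[l]}` ↦ `suffix L l = {k | l ≤ k}`), for a photon at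
position `i` whose lepton path occupies the positions `lpath i` (a nonempty set not containing `i`) and whose LARGEST path parameter sits at
position `m_i = min (lpath i)`:
* `heppZ_antitone`: in the sector (0 ≤ t, t_k ≤ 1) the parameters decrease along the numbering, so z′_i = z_{m_i} (`zPath_eq`);
* **`wFactor_eq` (the EXACT exponent, DERIVED)**: (z′_i)²/max(z′_i, z_i) = ∏_k t_k^{E_k(i)} with E_k(i) = [k ≤ m_i] + [i < k ≤ m_i] (open sector);
* **the LITERAL printed exponent** of (3.4) per photon, a_k(i) = [i ∈ Ph(IClos(s^{[k]}))] + [i ∈ IClos(s^{[k]})∖s^{[k]}] with Ph(X) = the photon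
  lines of X, unfolds (`printedExp_eq`) to [k ≤ i ∨ k ≤ m_i] + [k ≤ m_i ∧ i < k] (LPath(i) ⊆ s^{[k]} ⟺ k ≤ m_i; i ∈ s^{[k]} ⟺ k ≤ i);
  `eExp_le_printedExp`: E_k(i) ≤ a_k(i), `eExp_eq_printedExp_iff`: equality iff ¬(k ≤ i ∧ m_i < k) — they differ exactly by
  [i ∈ s^{[k]} ∧ LPath(i) ⊄ s^{[k]}] (`strict_example`: three lines, photon at position 1, path {0, 2}, level 1: E = 0 < 1 = a); hence
  **`prod_pow_aExp_le_prod_wFactor`: read literally, (3.4)'s second relation holds as "≥", not "="** (0 < t ≤ 1, natural weights r_i);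
* **the INTENDED reading** `capturedPh` = Ph⋆(s) := {i ∈ Ph(E(G)) : LPath(i) ⊆ s} = Ph(IClos(Lept(s))) (`capturedPh_eq_ph_iClos_lept`; the
  literal set is Ph(s) ∪ Ph⋆(s), `ph_iClos_eq_union`): with a⋆_k(i) = [i ∈ Ph⋆(s^{[k]})] + [i ∈ IClos(s^{[k]})∖s^{[k]}] one has **E_k(i) = a⋆_k(i)**
  (`eExp_eq_intendedExp`) and **(3.4) IS an identity** (`prod_wFactor_pow_eq_prod_pow_aExpIntended`); `aExpIntended_le_aExp`;
* **the one-loop vertex graph decides between the readings** (`oneLoop_readings`, by `decide`): lepton lines a, b and the photon γ with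
  LPath(γ) = {a, b}, P = ∅, in the sector z_a ≥ z_b ≥ z_γ — read literally, Lemma 3.6 fails at s^{[3]} = {γ} (|Ph(IClos({γ}))| = 1 > 0 =
  ⌊|Lept({γ})|/2⌋) and Lemma 3.7's r (r_i ∈ {0,1}, Σ r_i = |Ph(E(G))| − |P| = 1, (3.8) at every level) does not exist; read with Ph⋆, Lemma 3.6
  holds there (0 ≤ 0) and r_γ = 1 satisfies (3.8) at every level.
READING (V3b). In §3.2 — eq. (3.4)'s a_l, Lemma 3.5's A_l (3.6), Lemma 3.6, Lemma 3.7's (3.8)/(3.9) — the symbol Ph(IClos(s)) denotes the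
photons CAPTURED by s, Ph⋆(s) = {i : LPath(i) ⊆ s} = Ph(IClos(Lept(s))), not all photon lines of IClos(s): (a) Lemma 3.6's printed proof counts
exactly "photons with ends on h_j", i.e. Ph⋆(s), and proves |Ph⋆(s)| ≤ ⌊|Lept(s)|/2⌋; (b) with Ph⋆ the display (3.4) is the identity its "="
asserts; (c) Lemma 3.7's printed construction (zeroing r_i inside Ph(IClos(s^{[l]})) for l = L, …, 1, invariant "Σ(1 − r_i) ≤ |P|") goes through
verbatim for Ph⋆ (monotone in l) and yields (3.8) with Ph⋆; (d) Lemma 3.5 holds under BOTH readings (the literal a_l only weakens the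
intermediate bound, t_l ≤ 1), and the assembly "Lemmas 3.5 and 3.7 lead to |K/W^{L+u[P]}| ≤ C∏ t_l^{⌈−ω(IClos(s^{[l]}))⌉}/(z₁…z_L)", §3.3 and
**Theorem 3.1 (whose statement involves only ω(IClos(s^{[l]}))) stand AS PRINTED**. Read literally instead, (3.4)'s "=" is a "≥" (harmless),
but Lemma 3.6 is false at every single-photon set and Lemma 3.7's r fails to exist in every sector whose smallest parameter is a photon line
when P = ∅ — already for the one-loop graph — so the literal reading cannot be the intended one. Nothing on the track moves: B.1 / B.17 (1)
(finite MEAN, scope), B.22 (Lemma 3.4's arithmetic) and ORACLE-RULE (4c) (val(W) DERIVED from Lemma 3.4 directly, T1 L1 (b)) do not use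
(3.4)'s a_l or Lemmas 3.6–3.7.
NOT claimed: Lemma 3.4 itself (the circuit inequality Z ≤ Z_i ≤ Z₀ — `DenominatorLemmaArithmetic` has its arithmetic), the constant C, the
general Lemma 3.6 / 3.7 for Ph⋆ on the tree's graph model (only the one-loop instance is checked here), and (3.4)'s first relation beyond
monotonicity of powers; real weights r_i ≥ 0 are a `-- TODO(general form)` (`rpow`), the file takes r_i ∈ ℕ (Lemma 3.7: r_i ∈ {0,1}).
-/

namespace Literature.MathematicalPhysics.QuantumFieldTheory.Volkov2020

open Finset

noncomputable section

variable {L : ℕ}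

/-! ## The sector is monotone: z_k decreases along the numbering -/

/-- Splitting the defining product of `heppZ` at an earlier position: for a ≤ b, z_b = z_a · ∏_{a<k≤b} t_k. [cite: Volkov2020, §3.1 (journal p.10; tex l.296–300)] -/
theorem heppZ_split {R : Type*} [CommMonoid R] (t : Fin L → R) {a b : Fin L} (hab : a ≤ b) :
    heppZ t b = heppZ t a * ∏ k ∈ univ.filter (fun k : Fin L => (a : ℕ) < k ∧ (k : ℕ) ≤ b), t k := by
  unfold heppZ
  rw [← Finset.prod_union]
  · congr 1
    ext k
    simp only [Finset.mem_filter, Finset.mem_univ, true_and, Finset.mem_union]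
    have := hab
    rw [Fin.le_def] at this
    omega
  · rw [Finset.disjoint_filter]
    intro k _ h1 h2
    omega

/-- **The sector ordering**: for 0 ≤ t with t_k ≤ 1, the Feynman parameters decrease along the numbering, z_{k′} ≤ z_k for k ≤ k′ — the
sector (1.6) "z_{j₁} ≥ z_{j₂} ≥ … ≥ z_{j_L}" recovered from "t₁,…,t_L ≤ 1". [cite: Volkov2020, §3.1 eq. (1.6) (journal p.10; tex l.296–302)] -/
theorem heppZ_antitone (t : Fin L → ℝ) (ht0 : ∀ k, 0 ≤ t k) (ht1 : ∀ k, t k ≤ 1) {k k' : Fin L} (h : k ≤ k') :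
    heppZ t k' ≤ heppZ t k := by
  rw [heppZ_split t h]
  refine mul_le_of_le_one_right (heppZ_nonneg t ht0 k) ?_
  exact Finset.prod_le_one (fun i _ => ht0 i) fun i _ => ht1 i

/-! ## Photon data: lepton paths as position sets, the I-closure, z′_i -/

/-- **I-closure AS PRINTED**: IClos(s) = s ∪ {i ∈ Ph(E(G)) : LPath(i) ⊆ s} — photons `Ph` and lepton paths `lpath` given as sets of positions.
[cite: Volkov2020, §2.1 (journal p.7; tex l.168–173)] -/
def iClos (Ph : Finset (Fin L)) (lpath : Fin L → Finset (Fin L)) (s : Finset (Fin L)) : Finset (Fin L) :=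
  s ∪ Ph.filter fun i => lpath i ⊆ s

/-- **a_l AS PRINTED** (eq. (3.4)): a_l = Σ_{i∈Ph(IClos(s))} r_i + Σ_{i∈IClos(s)∖s} r_i, here for natural weights r_i (Lemma 3.7: r_i ∈ {0,1}).
[cite: Volkov2020, §3.2 eq. (3.4) (journal p.13; tex l.396–405)] -/
def aExp (Ph : Finset (Fin L)) (lpath : Fin L → Finset (Fin L)) (r : Fin L → ℕ) (s : Finset (Fin L)) : ℕ :=
  ∑ i ∈ iClos Ph lpath s ∩ Ph, r i + ∑ i ∈ iClos Ph lpath s \ s, r i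

/-- The position of the largest parameter on the lepton path of photon i: m_i = min LPath(i) (in the sector z decreases along the numbering);
junk value i for an empty path. [cite: Volkov2020, Lemma 3.4 («z′_i = max_{l∈LPath(i)} z_l»; journal p.12; tex l.366–368)] -/
def mPos (lpath : Fin L → Finset (Fin L)) (i : Fin L) : Fin L :=
  if h : (lpath i).Nonempty then (lpath i).min' h else i

/-- **z′_i AS PRINTED**: z′_i = max_{l∈LPath(i)} z_l (junk 0 for an empty path). [cite: Volkov2020, Lemma 3.4 (journal p.12; tex l.366–368)] -/
def zPath (t : Fin L → ℝ) (lpath : Fin L → Finset (Fin L)) (i : Fin L) : ℝ :=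
  if h : (lpath i).Nonempty then (lpath i).sup' h (heppZ t) else 0

/-- The factor of Lemma 3.4 / eq. (3.4): (z′_i)²/max(z′_i, z_i). [cite: Volkov2020, Lemma 3.4 eq. (3.3) and eq. (3.4) (journal p.12–13)] -/
def wFactor (t : Fin L → ℝ) (lpath : Fin L → Finset (Fin L)) (i : Fin L) : ℝ :=
  zPath t lpath i ^ 2 / max (zPath t lpath i) (heppZ t i)

/-- In the sector the maximum over the path is attained at its first position: z′_i = z_{m_i}. [cite: Volkov2020, Lemma 3.4 with §3.1 (journal p.10, p.12)] -/
theorem zPath_eq (t : Fin L → ℝ) (ht0 : ∀ k, 0 ≤ t k) (ht1 : ∀ k, t k ≤ 1) (lpath : Fin L → Finset (Fin L)) (i : Fin L)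
    (hne : (lpath i).Nonempty) : zPath t lpath i = heppZ t (mPos lpath i) := by
  unfold zPath mPos
  rw [dif_pos hne, dif_pos hne]
  apply le_antisymm
  · exact Finset.sup'_le _ _ fun l hl => heppZ_antitone t ht0 ht1 (Finset.min'_le _ _ hl)
  · exact Finset.le_sup' (heppZ t) (Finset.min'_mem _ hne)

/-! ## The exact exponent of (z′_i)²/max(z′_i, z_i) -/

/-- The EXACT exponent of t_k in (z′_i)²/max(z′_i, z_i): E_k(i) = [k ≤ m_i] + [i < k ≤ m_i] (DERIVED here; not printed).
[cite: Volkov2020, §3.2 eq. (3.4) (journal p.13) — the left product, exponent derived] -/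
def eExp (lpath : Fin L → Finset (Fin L)) (i k : Fin L) : ℕ :=
  (if k ≤ mPos lpath i then 1 else 0) + (if i < k ∧ k ≤ mPos lpath i then 1 else 0)

/-- A product of t_k to 0/1 exponents is the product over the selected positions. [cite: Volkov2020, Lemma 3.1 (journal p.11)] -/
private theorem prod_pow_indicator {R : Type*} [CommMonoid R] (t : Fin L → R) (p : Fin L → Prop) [DecidablePred p] :
    ∏ k : Fin L, t k ^ (if p k then 1 else 0) = ∏ k ∈ univ.filter p, t k := by
  rw [Finset.prod_filter]
  refine Finset.prod_congr rfl fun k _ => ?_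
  split_ifs <;> simp

/-- **The exact sector form of Lemma 3.4's factor** (open sector 0 < t ≤ 1; photon i not on its own nonempty lepton path):
(z′_i)²/max(z′_i, z_i) = ∏_k t_k^{E_k(i)}, E_k(i) = [k ≤ m_i] + [i < k ≤ m_i]. [cite: Volkov2020, §3.2 eq. (3.4) (journal p.13; tex l.396–405)] -/
theorem wFactor_eq (t : Fin L → ℝ) (ht : ∀ k, 0 < t k) (ht1 : ∀ k, t k ≤ 1) (lpath : Fin L → Finset (Fin L)) (i : Fin L)
    (hne : (lpath i).Nonempty) (hi : i ∉ lpath i) :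
    wFactor t lpath i = ∏ k : Fin L, t k ^ eExp lpath i k := by
  have ht0 : ∀ k, 0 ≤ t k := fun k => (ht k).le
  have hzpos : ∀ k, 0 < heppZ t k := heppZ_pos t ht
  set m := mPos lpath i with hm
  have hmmem : m ∈ lpath i := by
    simp only [hm, mPos, dif_pos hne]; exact Finset.min'_mem _ hne
  have hmi : m ≠ i := fun h => hi (h ▸ hmmem)
  unfold wFactor eExp
  rw [zPath_eq t ht0 ht1 lpath i hne, ← hm]
  simp_rw [pow_add]
  rw [Finset.prod_mul_distrib, prod_pow_indicator, prod_pow_indicator]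
  have hzm : ∏ k ∈ univ.filter (fun k : Fin L => k ≤ m), t k = heppZ t m := by
    unfold heppZ; rfl
  rw [hzm]
  rcases lt_or_gt_of_ne hmi with hlt | hgt
  · -- m < i : the photon is smaller than its whole path, max(z′, z_i) = z′ = z_m, and no k has i < k ≤ m
    have hmax : max (heppZ t m) (heppZ t i) = heppZ t m := max_eq_left (heppZ_antitone t ht0 ht1 hlt.le)
    have hempty : univ.filter (fun k : Fin L => i < k ∧ k ≤ m) = ∅ := by
      ext k
      simp only [Finset.mem_filter, Finset.mem_univ, true_and, Finset.notMem_empty, iff_false, not_and, not_le]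
      intro hik
      exact hlt.trans hik
    rw [hmax, hempty, Finset.prod_empty, mul_one, pow_two, mul_div_assoc, div_self (hzpos m).ne', mul_one]
  · -- i < m : max(z′, z_i) = z_i and z_m = z_i · ∏_{i<k≤m} t_k
    have hmax : max (heppZ t m) (heppZ t i) = heppZ t i := max_eq_right (heppZ_antitone t ht0 ht1 hgt.le)
    have hsplit := heppZ_split t hgt.le
    have hfilt : univ.filter (fun k : Fin L => (i : ℕ) < k ∧ (k : ℕ) ≤ m) = univ.filter (fun k : Fin L => i < k ∧ k ≤ m) := by
      ext k; simp
    rw [hfilt] at hsplit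
    rw [hmax, hsplit, div_eq_iff (hzpos i).ne']
    ring

/-! ## The printed exponent and the comparison -/

/-- **The printed per-photon exponent of (3.4)** at the level s = `suffix L k`: a_k(i) = [i ∈ Ph(IClos(s^{[k]}))] + [i ∈ IClos(s^{[k]})∖s^{[k]}]
(so that a_l = Σ_i r_i·a_l(i)). [cite: Volkov2020, §3.2 eq. (3.4) (journal p.13; tex l.401–405)] -/
def printedExp (Ph : Finset (Fin L)) (lpath : Fin L → Finset (Fin L)) (i : Fin L) (k : ℕ) : ℕ :=
  (if i ∈ iClos Ph lpath (suffix L k) ∩ Ph then 1 else 0) + (if i ∈ iClos Ph lpath (suffix L k) \ suffix L k then 1 else 0)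

/-- LPath(i) ⊆ s^{[k]} iff the path's first position is ≥ k, i.e. k ≤ m_i. [cite: Volkov2020, §2.1 I-closure with §3.1 s^{[l]} (journal p.7, p.10)] -/
theorem lpath_subset_suffix_iff (lpath : Fin L → Finset (Fin L)) (i : Fin L) (hne : (lpath i).Nonempty) (k : ℕ) :
    lpath i ⊆ suffix L k ↔ k ≤ (mPos lpath i : ℕ) := by
  unfold mPos
  rw [dif_pos hne]
  constructor
  · intro h
    have := h (Finset.min'_mem _ hne)
    rwa [mem_suffix] at this
  · intro h l hl
    rw [mem_suffix]
    exact h.trans (Finset.min'_le _ _ hl)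

/-- The printed exponent unfolded in positions: a_k(i) = [k ≤ i ∨ k ≤ m_i] + [k ≤ m_i ∧ i < k] for a photon i ∈ Ph.
[cite: Volkov2020, §3.2 eq. (3.4) with §2.1 (journal p.13, p.7)] -/
theorem printedExp_eq (Ph : Finset (Fin L)) (lpath : Fin L → Finset (Fin L)) {i : Fin L} (hiPh : i ∈ Ph)
    (hne : (lpath i).Nonempty) (k : ℕ) :
    printedExp Ph lpath i k =
      (if k ≤ (i : ℕ) ∨ k ≤ (mPos lpath i : ℕ) then 1 else 0) + (if k ≤ (mPos lpath i : ℕ) ∧ (i : ℕ) < k then 1 else 0) := by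
  unfold printedExp iClos
  have h1 : (i ∈ (suffix L k ∪ Ph.filter fun j => lpath j ⊆ suffix L k) ∩ Ph) ↔ (k ≤ (i : ℕ) ∨ k ≤ (mPos lpath i : ℕ)) := by
    rw [Finset.mem_inter, Finset.mem_union, Finset.mem_filter, mem_suffix, lpath_subset_suffix_iff lpath i hne]
    tauto
  have h2 : (i ∈ (suffix L k ∪ Ph.filter fun j => lpath j ⊆ suffix L k) \ suffix L k) ↔ (k ≤ (mPos lpath i : ℕ) ∧ (i : ℕ) < k) := by
    rw [Finset.mem_sdiff, Finset.mem_union, Finset.mem_filter, mem_suffix, lpath_subset_suffix_iff lpath i hne, not_le]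
    constructor
    · rintro ⟨h | ⟨_, h⟩, hlt⟩
      · exact absurd h (not_le.2 hlt)
      · exact ⟨h, hlt⟩
    · rintro ⟨h, hlt⟩
      exact ⟨Or.inr ⟨hiPh, h⟩, hlt⟩
  rw [if_congr h1 rfl rfl, if_congr h2 rfl rfl]

/-- **E ≤ a**: the exact exponent of t_k never exceeds the printed one. [cite: Volkov2020, §3.2 eq. (3.4) (journal p.13)] -/
theorem eExp_le_printedExp (Ph : Finset (Fin L)) (lpath : Fin L → Finset (Fin L)) {i : Fin L} (hiPh : i ∈ Ph)
    (hne : (lpath i).Nonempty) (k : Fin L) :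
    eExp lpath i k ≤ printedExp Ph lpath i k := by
  rw [printedExp_eq Ph lpath hiPh hne]
  unfold eExp
  simp only [Fin.le_def, Fin.lt_def]
  split_ifs <;> omega

/-- **When they agree**: E_k(i) = a_k(i) iff NOT (i ∈ s^{[k]} and LPath(i) ⊄ s^{[k]}), i.e. ¬(k ≤ i ∧ m_i < k): the printed "=" of (3.4) is
exact precisely when no counted photon sits inside s^{[l]} with part of its lepton path outside. [cite: Volkov2020, §3.2 eq. (3.4) (journal p.13)] -/
theorem eExp_eq_printedExp_iff (Ph : Finset (Fin L)) (lpath : Fin L → Finset (Fin L)) {i : Fin L} (hiPh : i ∈ Ph)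
    (hne : (lpath i).Nonempty) (k : Fin L) :
    eExp lpath i k = printedExp Ph lpath i k ↔ ¬ ((k : ℕ) ≤ (i : ℕ) ∧ (mPos lpath i : ℕ) < (k : ℕ)) := by
  rw [printedExp_eq Ph lpath hiPh hne]
  unfold eExp
  simp only [Fin.le_def, Fin.lt_def]
  constructor
  · intro h
    split_ifs at h <;> omega
  · intro h
    split_ifs <;> omega

/-- **Strictness does occur**: three lines, the photon at position 1 with lepton path {0, 2} (its larger path line before it, the smaller after
it); at level k = 1 the printed exponent is 1 while the exact one is 0 — there (z′)²/max(z′, z) = z₀ = t₀, but t^{a} carries t₀t₁.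
[cite: Volkov2020, §3.2 eq. (3.4) (journal p.13) — witness that "=" is "≥"] -/
theorem strict_example :
    let lpath : Fin 3 → Finset (Fin 3) := fun _ => {0, 2}
    eExp lpath 1 1 = 0 ∧ printedExp ({1} : Finset (Fin 3)) lpath 1 1 = 1 := by
  decide

/-! ## Eq. (3.4) as an inequality -/

/-- The printed a_l is the r-weighted sum of the per-photon printed exponents (photons outside Ph never enter IClos(s)∖s).
[cite: Volkov2020, §3.2 eq. (3.4) (journal p.13; tex l.401–405)] -/
theorem aExp_eq_sum (Ph : Finset (Fin L)) (lpath : Fin L → Finset (Fin L)) (r : Fin L → ℕ) (k : ℕ) :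
    aExp Ph lpath r (suffix L k) = ∑ i ∈ Ph, r i * printedExp Ph lpath i k := by
  unfold aExp printedExp
  simp_rw [mul_add, mul_ite, mul_one, mul_zero, Finset.sum_add_distrib]
  congr 1
  · rw [← Finset.sum_filter]
    congr 1
    ext i
    simp only [Finset.mem_inter, Finset.mem_filter]
    tauto
  · rw [← Finset.sum_filter]
    congr 1
    ext i
    simp only [Finset.mem_sdiff, Finset.mem_filter, iClos, Finset.mem_union]
    constructor
    · rintro ⟨h | h, hn⟩
      · exact absurd h hn
      · exact ⟨h.1, Or.inr h, hn⟩
    · rintro ⟨_, h, hn⟩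
      exact ⟨h, hn⟩

/-- The left product of (3.4) in sector variables: ∏_{i∈Ph} ((z′_i)²/max(z′_i,z_i))^{r_i} = ∏_k t_k^{Σ_i r_i E_k(i)} (open sector).
[cite: Volkov2020, §3.2 eq. (3.4) (journal p.13) — exact form] -/
theorem prod_wFactor_pow_eq (t : Fin L → ℝ) (ht : ∀ k, 0 < t k) (ht1 : ∀ k, t k ≤ 1) (Ph : Finset (Fin L))
    (lpath : Fin L → Finset (Fin L)) (hne : ∀ i ∈ Ph, (lpath i).Nonempty) (hnot : ∀ i ∈ Ph, i ∉ lpath i) (r : Fin L → ℕ) :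
    ∏ i ∈ Ph, wFactor t lpath i ^ r i = ∏ k : Fin L, t k ^ ∑ i ∈ Ph, r i * eExp lpath i k := by
  rw [Finset.prod_congr rfl fun i hi => by rw [wFactor_eq t ht ht1 lpath i (hne i hi) (hnot i hi)]]
  simp_rw [← Finset.prod_pow, ← pow_mul]
  rw [Finset.prod_comm]
  refine Finset.prod_congr rfl fun k _ => ?_
  rw [Finset.prod_pow_eq_pow_sum]
  refine congrArg _ (Finset.sum_congr rfl fun i _ => ?_)
  ring

/-- **Eq. (3.4) holds with "≥"**: in the open sector 0 < t ≤ 1, for photons i ∈ Ph with nonempty lepton paths not containing i and natural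
weights r_i, `∏_l t_l^{a_l} ≤ ∏_{i∈Ph} ((z′_i)²/max(z′_i, z_i))^{r_i}` with a_l AS PRINTED — so "|W(z)|^M ≥ C·∏(…)^{r_i} ≥ C·∏ t_l^{a_l}", which
is all that Lemma 3.5 uses. (`-- TODO(general form)`: real weights r_i ≥ 0.) [cite: Volkov2020, §3.2 eq. (3.4) and proof of Lemma 3.5 (journal p.13; tex l.396–431)] -/
theorem prod_pow_aExp_le_prod_wFactor (t : Fin L → ℝ) (ht : ∀ k, 0 < t k) (ht1 : ∀ k, t k ≤ 1) (Ph : Finset (Fin L))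
    (lpath : Fin L → Finset (Fin L)) (hne : ∀ i ∈ Ph, (lpath i).Nonempty) (hnot : ∀ i ∈ Ph, i ∉ lpath i) (r : Fin L → ℕ) :
    ∏ k : Fin L, t k ^ aExp Ph lpath r (suffix L k) ≤ ∏ i ∈ Ph, wFactor t lpath i ^ r i := by
  rw [prod_wFactor_pow_eq t ht ht1 Ph lpath hne hnot r]
  refine Finset.prod_le_prod (fun k _ => pow_nonneg (ht k).le _) fun k _ => ?_
  refine pow_le_pow_of_le_one (ht k).le (ht1 k) ?_
  rw [aExp_eq_sum]
  exact Finset.sum_le_sum fun i hi => Nat.mul_le_mul_left _ (eExp_le_printedExp Ph lpath hi (hne i hi) k)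

/-! ## The intended reading: the photons CAPTURED by s, Ph(IClos(Lept(s))) -/

/-- **Ph⋆(s)**: the photons whose lepton path lies in s, `{i ∈ Ph(E(G)) : LPath(i) ⊆ s}` — the set Lemma 3.6's proof actually counts ("photons with
ends on h_j contributing to |Ph(IClos(s))|") and under which (3.4) is an identity; it is Ph(IClos(Lept(s))) (`capturedPh_eq_ph_iClos_lept`), whereas
the literal Ph(IClos(s)) is Ph(s) ∪ Ph⋆(s). [cite: Volkov2020, §2.1 I-closure and proof of Lemma 3.6 (journal p.7, p.13; tex l.171–173, l.449–458)] -/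
def capturedPh (Ph : Finset (Fin L)) (lpath : Fin L → Finset (Fin L)) (s : Finset (Fin L)) : Finset (Fin L) :=
  Ph.filter fun i => lpath i ⊆ s

/-- The literal photon set of the I-closure splits as Ph(IClos(s)) = Ph(s) ∪ Ph⋆(s). [cite: Volkov2020, §2.1 (journal p.7; tex l.171–173)] -/
theorem ph_iClos_eq_union (Ph : Finset (Fin L)) (lpath : Fin L → Finset (Fin L)) (s : Finset (Fin L)) :
    iClos Ph lpath s ∩ Ph = s ∩ Ph ∪ capturedPh Ph lpath s := by
  ext i
  simp only [iClos, capturedPh, Finset.mem_inter, Finset.mem_union, Finset.mem_filter]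
  tauto

/-- Ph⋆(s) = Ph(IClos(Lept(s))): applying the I-closure to the LEPTON lines of s captures exactly the photons whose path lies in s (lepton paths
contain no photon lines). [cite: Volkov2020, §2.1 (journal p.7; tex l.168–173)] -/
theorem capturedPh_eq_ph_iClos_lept (Ph : Finset (Fin L)) (lpath : Fin L → Finset (Fin L))
    (hpath : ∀ i ∈ Ph, Disjoint (lpath i) Ph) (s : Finset (Fin L)) :
    capturedPh Ph lpath s = iClos Ph lpath (s \ Ph) ∩ Ph := by
  ext i
  simp only [capturedPh, iClos, Finset.mem_filter, Finset.mem_inter, Finset.mem_union, Finset.mem_sdiff]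
  constructor
  · rintro ⟨hi, hsub⟩
    refine ⟨Or.inr ⟨hi, fun l hl => Finset.mem_sdiff.2 ⟨hsub hl, ?_⟩⟩, hi⟩
    exact Finset.disjoint_left.1 (hpath i hi) hl
  · rintro ⟨h | ⟨hi, hsub⟩, hi'⟩
    · exact absurd hi' h.2
    · exact ⟨hi, fun l hl => (Finset.mem_sdiff.1 (hsub hl)).1⟩

/-- The per-photon exponent under the intended reading: a⋆_k(i) = [i ∈ Ph⋆(s^{[k]})] + [i ∈ IClos(s^{[k]})∖s^{[k]}].
[cite: Volkov2020, §3.2 eq. (3.4) (journal p.13) — with Ph(IClos(s)) read as Ph(IClos(Lept(s)))] -/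
def intendedExp (Ph : Finset (Fin L)) (lpath : Fin L → Finset (Fin L)) (i : Fin L) (k : ℕ) : ℕ :=
  (if i ∈ capturedPh Ph lpath (suffix L k) then 1 else 0) + (if i ∈ iClos Ph lpath (suffix L k) \ suffix L k then 1 else 0)

/-- a⋆_k(i) in positions: [k ≤ m_i] + [k ≤ m_i ∧ i < k]. [cite: Volkov2020, §3.2 eq. (3.4) (journal p.13)] -/
theorem intendedExp_eq (Ph : Finset (Fin L)) (lpath : Fin L → Finset (Fin L)) {i : Fin L} (hiPh : i ∈ Ph)
    (hne : (lpath i).Nonempty) (k : ℕ) :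
    intendedExp Ph lpath i k =
      (if k ≤ (mPos lpath i : ℕ) then 1 else 0) + (if k ≤ (mPos lpath i : ℕ) ∧ (i : ℕ) < k then 1 else 0) := by
  unfold intendedExp iClos capturedPh
  have h1 : (i ∈ Ph.filter fun j => lpath j ⊆ suffix L k) ↔ k ≤ (mPos lpath i : ℕ) := by
    rw [Finset.mem_filter, lpath_subset_suffix_iff lpath i hne]
    tauto
  have h2 : (i ∈ (suffix L k ∪ Ph.filter fun j => lpath j ⊆ suffix L k) \ suffix L k) ↔ (k ≤ (mPos lpath i : ℕ) ∧ (i : ℕ) < k) := by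
    rw [Finset.mem_sdiff, Finset.mem_union, Finset.mem_filter, mem_suffix, lpath_subset_suffix_iff lpath i hne, not_le]
    constructor
    · rintro ⟨h | ⟨_, h⟩, hlt⟩
      · exact absurd h (not_le.2 hlt)
      · exact ⟨h, hlt⟩
    · rintro ⟨h, hlt⟩
      exact ⟨Or.inr ⟨hiPh, h⟩, hlt⟩
  rw [if_congr h1 rfl rfl, if_congr h2 rfl rfl]

/-- **Under the intended reading the exponent is EXACT**: E_k(i) = a⋆_k(i). [cite: Volkov2020, §3.2 eq. (3.4) (journal p.13)] -/
theorem eExp_eq_intendedExp (Ph : Finset (Fin L)) (lpath : Fin L → Finset (Fin L)) {i : Fin L} (hiPh : i ∈ Ph)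
    (hne : (lpath i).Nonempty) (k : Fin L) :
    eExp lpath i k = intendedExp Ph lpath i k := by
  rw [intendedExp_eq Ph lpath hiPh hne]
  unfold eExp
  simp only [Fin.le_def, Fin.lt_def]
  split_ifs <;> omega

/-- a⋆_l := Σ_{i∈Ph⋆(s)} r_i + Σ_{i∈IClos(s)∖s} r_i — (3.4)'s exponent under the intended reading. [cite: Volkov2020, §3.2 eq. (3.4) (journal p.13)] -/
def aExpIntended (Ph : Finset (Fin L)) (lpath : Fin L → Finset (Fin L)) (r : Fin L → ℕ) (s : Finset (Fin L)) : ℕ :=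
  ∑ i ∈ capturedPh Ph lpath s, r i + ∑ i ∈ iClos Ph lpath s \ s, r i

/-- a⋆_l as an r-weighted sum of per-photon exponents. [cite: Volkov2020, §3.2 eq. (3.4) (journal p.13)] -/
theorem aExpIntended_eq_sum (Ph : Finset (Fin L)) (lpath : Fin L → Finset (Fin L)) (r : Fin L → ℕ) (k : ℕ) :
    aExpIntended Ph lpath r (suffix L k) = ∑ i ∈ Ph, r i * intendedExp Ph lpath i k := by
  unfold aExpIntended intendedExp
  simp_rw [mul_add, mul_ite, mul_one, mul_zero, Finset.sum_add_distrib]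
  congr 1
  · rw [← Finset.sum_filter]
    congr 1
    ext i
    simp only [capturedPh, Finset.mem_filter]
    tauto
  · rw [← Finset.sum_filter]
    congr 1
    ext i
    simp only [Finset.mem_sdiff, Finset.mem_filter, iClos, Finset.mem_union]
    constructor
    · rintro ⟨h | h, hn⟩
      · exact absurd h hn
      · exact ⟨h.1, Or.inr h, hn⟩
    · rintro ⟨_, h, hn⟩
      exact ⟨h, hn⟩

/-- a⋆_l ≤ a_l: the intended exponent never exceeds the literal one (Ph⋆(s) ⊆ Ph(IClos(s))). [cite: Volkov2020, §3.2 eq. (3.4) (journal p.13)] -/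
theorem aExpIntended_le_aExp (Ph : Finset (Fin L)) (lpath : Fin L → Finset (Fin L)) (r : Fin L → ℕ) (s : Finset (Fin L)) :
    aExpIntended Ph lpath r s ≤ aExp Ph lpath r s := by
  unfold aExpIntended aExp
  refine Nat.add_le_add_right (Finset.sum_le_sum_of_subset fun i hi => ?_) _
  rw [ph_iClos_eq_union, Finset.mem_union]
  exact Or.inr hi

/-- **(3.4) IS AN IDENTITY under the intended reading**: in the open sector 0 < t ≤ 1, ∏_{i∈Ph} ((z′_i)²/max(z′_i, z_i))^{r_i} = ∏_l t_l^{a⋆_l}.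
[cite: Volkov2020, §3.2 eq. (3.4) (journal p.13; tex l.396–405) — with Ph(IClos(s)) read as Ph(IClos(Lept(s)))] -/
theorem prod_wFactor_pow_eq_prod_pow_aExpIntended (t : Fin L → ℝ) (ht : ∀ k, 0 < t k) (ht1 : ∀ k, t k ≤ 1) (Ph : Finset (Fin L))
    (lpath : Fin L → Finset (Fin L)) (hne : ∀ i ∈ Ph, (lpath i).Nonempty) (hnot : ∀ i ∈ Ph, i ∉ lpath i) (r : Fin L → ℕ) :
    ∏ i ∈ Ph, wFactor t lpath i ^ r i = ∏ k : Fin L, t k ^ aExpIntended Ph lpath r (suffix L k) := by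
  rw [prod_wFactor_pow_eq t ht ht1 Ph lpath hne hnot r]
  refine Finset.prod_congr rfl fun k _ => ?_
  rw [aExpIntended_eq_sum]
  refine congrArg _ (Finset.sum_congr rfl fun i hi => ?_)
  rw [eExp_eq_intendedExp Ph lpath hi (hne i hi) k]

/-! ## The one-loop vertex graph in the sector z_a ≥ z_b ≥ z_γ: the literal reading breaks Lemmas 3.6 / 3.7, the intended one does not -/

/-- On the ONE-LOOP magnetic-moment graph (lepton lines a, b at positions 0, 1; the photon γ at position 2, LPath(γ) = {a, b}; no pairs, P = ∅)
in the sector where the photon parameter is the smallest: (i) literal Lemma 3.6 at s^{[3]} = {γ} reads |Ph(IClos({γ}))| = 1 ≤ ⌊|Lept({γ})|/2⌋ = 0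
— false; with Ph⋆ it reads 0 ≤ 0; (ii) literal (3.8) with Σ_i r_i = |Ph(E(G))| − |P| = 1, r_i ∈ {0,1}, has NO solution (level 3 forces r_γ = 0),
while with Ph⋆ the printed choice r_γ = 1 satisfies every level. [cite: Volkov2020, Lemma 3.6 and Lemma 3.7 eq. (3.8) (journal p.13–14; tex l.442–484) — readings compared] -/
theorem oneLoop_readings :
    let Ph : Finset (Fin 3) := {2}
    let lpath : Fin 3 → Finset (Fin 3) := fun _ => {0, 1}
    (iClos Ph lpath {2} ∩ Ph).card = 1 ∧ ((({2} : Finset (Fin 3)) \ Ph).card / 2 = 0) ∧ (capturedPh Ph lpath {2}).card = 0 ∧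
    (¬ ∃ r : Fin 3 → Fin 2, (r 2 : ℕ) = 1 ∧
        ∀ l : Fin 4, ∑ i ∈ iClos Ph lpath (suffix 3 l) ∩ Ph, (r i : ℕ) ≤ (suffix 3 l \ Ph).card / 2) ∧
    (∃ r : Fin 3 → Fin 2, (r 2 : ℕ) = 1 ∧
        ∀ l : Fin 4, ∑ i ∈ capturedPh Ph lpath (suffix 3 l), (r i : ℕ) ≤ (suffix 3 l \ Ph).card / 2) := by
  decide

end

end Literature.MathematicalPhysics.QuantumFieldTheory.Volkov2020
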